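/-
Copyright: b2b-lace cell (CriticalPhenomena). Text-final: carver-g60 desk `W3G_glue_v60.lean` (41338f7d56582186, the
two slot theorems verbatim) + carver-g62 citation header; filed by the lean1 thread as a filler under LEAD ruling W-18
(STATUS, carver-g62) if the referee endorses it; D98-neutral algebra over `NobleWeightedDiagSplit`; no numeral; d-generic.
-/
import Literature.Probability.FitznerVanDerHofstad2017.NobleWeightedDiagSplit
import HarnessLib

/-!
# [FvdH17] Lemma 5.1 VERSION 2 (raw): slot assembly of the one-side-trivial sums `R_R`, `R_L` from ι-summed class bounds

CITATION HEADER (PLACEMENT v2). This module is part of a certified REPRODUCTION of: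
R. Fitzner, R. van der Hofstad, *Mean-field behavior for nearest-neighbor percolation in `d > 10`*, Electron. J.
Probab. **22** (2017) no. 43 [FvdH17] (arXiv:1506.07977v2): §4.4 (4.65) (p. 43, the weighted diagram `Ξ^{(1)}`),
Lemma 5.1 second version (p. 50, the bound with the two one-side-trivial sums `R_R`, `R_L` carried raw), §6.1 (p. 59)
and App. C.1 of the extended version (pp. 79–80, the case split of the right-trivial diagram by the position of `u, w`,
the left-trivial one "in the same way").  Origin: build `lace` (host summit CriticalPhenomena); node N76-XI1DELTA ∕ W3,
desk object W3-G (glue) of the LEAD (carver-g60 v60; carver-g62 header).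

WHAT THIS FILE DOES (all `d`-generic; every letter family — the start letters `Sn`, the exit letters `En`, the
four-point family `Ab` — is a PARAMETER; no percolation event, no inequality between letters, no numeral).  The tree's
`NobleWeightedN1Assembly` writes the one-side-trivial sums as `rawR Sn Ab = Σ_{ι,a} rawRPiece Sn Ab ι a` and
`rawL Ab En = Σ_{ι,b} rawLPiece Ab En ι b` (`rawR_eq_sum_rawRPiece`, `rawL_eq_sum_rawLPiece`, classes `a, b ∈ {0,1,2}`),
and `NobleWeightedDiagSplit` splits each piece: `rawRPiece = rawRPieceAt0 + rawRDiag + rawROffDiag` (the rows `w = 0`,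
the diagonal `x = w ≠ 0`, the off-diagonal remainder) and `rawLPiece = rawLDiag + rawLOffDiag` (the diagonal `t = e_ι`
and its complement).  This file only ASSEMBLES: given upper bounds for the ι-summed class-`0` pieces taken whole and,
for the classes `1` and `2`, for each ι-summed addend of the split separately, it concludes the corresponding bound on
`rawR Sn Ab` ∕ `rawL Ab En` (two theorems, `rawR_le_of_slots`, `rawL_le_of_slots`).  The bounds (`FA, FB₁, …`, `GA, GΔ₁,
…`) are free PARAMETERS in `ℝ≥0∞`: which tree theorem fills which slot (the class-`0` cases, the `w = 0` rows, the
diagonal and off-diagonal leaves of either side) is decided by the module that instantiates these two theorems, not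
here.  The regrouping is elementary algebra over the tree's objects (exchange of the finite sums over `ι` and over the
class, `Fin.sum_univ_three`, `Finset.sum_add_distrib`, monotonicity of `+`) and is NOT a step made in print, whose
App. C.1 bounds the right-trivial diagram case by case in letters (DIVERGENCE D98 ∕ GAPS G-D98 of the packet record what
print's letters do and do not separate; nothing of that is decided or used here).  Nothing landed is modified; no cited
hypothesis — every statement is a kernel-proved inequality between the tree's objects and free parameters.
-/

noncomputable section

namespace Literature.Probability.FitznerVanDerHofstad2017

open scoped BigOperators ENNReal
open Literature.Probability.LatticeModels Literature.Probability.Percolation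
open Literature.Probability.FitznerVanDerHofstad2017.BlockSummation
open Literature.Probability.FitznerVanDerHofstad2017.NobleBlocks

variable {d : ℕ}

/-! ## A. Right side trivial: `R_R` from seven ι-summed slots -/

/-- **Slot assembly of `R_R`**: if the ι-summed class-`0` pieces are `≤ FA`, and for the classes `a = 1, 2` the
ι-summed rows `w = 0` are `≤ FBₐ`, the ι-summed diagonal `x = w ≠ 0` is `≤ FΔₐ` and the ι-summed off-diagonal remainder
is `≤ FOₐ`, then `R_R = rawR Sn Ab ≤ FA + (FB₁ + FΔ₁ + FO₁) + (FB₂ + FΔ₂ + FO₂)`.  Pure regrouping of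
`rawR_eq_sum_rawRPiece` and `rawRPiece_eq_at0_add_diag_add_offDiag`; the slots are free parameters.
[cite: FitznerVanDerHofstad2017, Lemma 5.1 second version (arXiv:1506.07977v2 p. 50); §4.4 (4.65) (p. 43); App. C.1 (pp. 79–80)] -/
theorem rawR_le_of_slots (Sn : Fin 3 → Site d → Site d → ℝ≥0∞) (Ab : DirBlockFamily d)
    {FA FB₁ FΔ₁ FO₁ FB₂ FΔ₂ FO₂ : ℝ≥0∞}
    (hA : ∑ ι : Fin d × Bool, rawRPiece Sn Ab ι 0 ≤ FA)
    (hB₁ : ∑ ι : Fin d × Bool, rawRPieceAt0 Sn Ab ι 1 ≤ FB₁)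
    (hΔ₁ : ∑ ι : Fin d × Bool, rawRDiag Sn Ab ι 1 ≤ FΔ₁)
    (hO₁ : ∑ ι : Fin d × Bool, rawROffDiag Sn Ab ι 1 ≤ FO₁)
    (hB₂ : ∑ ι : Fin d × Bool, rawRPieceAt0 Sn Ab ι 2 ≤ FB₂)
    (hΔ₂ : ∑ ι : Fin d × Bool, rawRDiag Sn Ab ι 2 ≤ FΔ₂)
    (hO₂ : ∑ ι : Fin d × Bool, rawROffDiag Sn Ab ι 2 ≤ FO₂) :
    rawR Sn Ab ≤ FA + (FB₁ + FΔ₁ + FO₁) + (FB₂ + FΔ₂ + FO₂) := by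
  rw [rawR_eq_sum_rawRPiece, Finset.sum_comm]
  simp only [Fin.sum_univ_three]
  have h1 : ∑ ι : Fin d × Bool, rawRPiece Sn Ab ι 1 ≤ FB₁ + FΔ₁ + FO₁ := by
    simp only [rawRPiece_eq_at0_add_diag_add_offDiag, Finset.sum_add_distrib]
    exact add_le_add (add_le_add hB₁ hΔ₁) hO₁
  have h2 : ∑ ι : Fin d × Bool, rawRPiece Sn Ab ι 2 ≤ FB₂ + FΔ₂ + FO₂ := by
    simp only [rawRPiece_eq_at0_add_diag_add_offDiag, Finset.sum_add_distrib]
    exact add_le_add (add_le_add hB₂ hΔ₂) hO₂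
  exact add_le_add (add_le_add hA h1) h2

/-! ## B. Left side trivial: `R_L` from five ι-summed slots -/

/-- **Slot assembly of `R_L`**: if the ι-summed class-`0` pieces are `≤ GA`, and for the classes `b = 1, 2` the
ι-summed diagonal `t = e_ι` is `≤ GΔ_b` and the ι-summed off-diagonal remainder is `≤ GO_b`, then
`R_L = rawL Ab En ≤ GA + (GΔ₁ + GO₁) + (GΔ₂ + GO₂)`.  Pure regrouping of `rawL_eq_sum_rawLPiece` and
`rawLPiece_eq_diag_add_offDiag`; the slots are free parameters.
[cite: FitznerVanDerHofstad2017, Lemma 5.1 second version (arXiv:1506.07977v2 p. 50); §4.4 (4.65) (p. 43); App. C.1 (pp. 79–80)] -/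
theorem rawL_le_of_slots (Ab : DirBlockFamily d) (En : Fin 3 → Site d → Site d → ℝ≥0∞)
    {GA GΔ₁ GO₁ GΔ₂ GO₂ : ℝ≥0∞}
    (gA : ∑ ι : Fin d × Bool, rawLPiece Ab En ι 0 ≤ GA)
    (gΔ₁ : ∑ ι : Fin d × Bool, rawLDiag Ab En ι 1 ≤ GΔ₁)
    (gO₁ : ∑ ι : Fin d × Bool, rawLOffDiag Ab En ι 1 ≤ GO₁)
    (gΔ₂ : ∑ ι : Fin d × Bool, rawLDiag Ab En ι 2 ≤ GΔ₂)
    (gO₂ : ∑ ι : Fin d × Bool, rawLOffDiag Ab En ι 2 ≤ GO₂) :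
    rawL Ab En ≤ GA + (GΔ₁ + GO₁) + (GΔ₂ + GO₂) := by
  rw [rawL_eq_sum_rawLPiece, Finset.sum_comm]
  simp only [Fin.sum_univ_three]
  have h1 : ∑ ι : Fin d × Bool, rawLPiece Ab En ι 1 ≤ GΔ₁ + GO₁ := by
    simp only [rawLPiece_eq_diag_add_offDiag, Finset.sum_add_distrib]
    exact add_le_add gΔ₁ gO₁
  have h2 : ∑ ι : Fin d × Bool, rawLPiece Ab En ι 2 ≤ GΔ₂ + GO₂ := by
    simp only [rawLPiece_eq_diag_add_offDiag, Finset.sum_add_distrib]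
    exact add_le_add gΔ₂ gO₂
  exact add_le_add (add_le_add gA h1) h2

end Literature.Probability.FitznerVanDerHofstad2017

end
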